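/-
Copyright (c) 2026 the pub-hodgecm-mathlib formalisation cell (harness21).  Prover seat hodgecm-mathlib-K2Liu-p02 (g4), Track B «K2-LIT» ∕
hLiu418 #184♮, socket #42R `sig_K2LiuEisensteinResidueIsThetaIntegral`, organ (FI)+(R0) «INTEGRATION ∕ RESTRICTION ALONG A BLOCK OF
COORDINATES PRESERVES `𝒮(𝔸_K^{ι₁ ⊕ ι₂})`» (LEAD F0P6-plan (g11) ruling «M-155e» (3) «Ikeda DEFS», 2026-09-04).
-/
import Literature.NumberTheory.Automorphic.AdelicPiSchwartzBruhatFourier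
import Literature.Topology.LocallyConstantCompactSupportUniform
import Literature.NumberTheory.Automorphic.QuaternionAlgebraAdelicProofs   -- ★ `t2Space_finiteAdeleRing`
import Summits.HodgeConjecture.HodgeConjecture.Theorems.K2LiuSchwartzFibreIntegral

/-!
# Crux `HLiu418`, road `K2_Liu`, socket #42R — organ (FI)+(R0): integration and restriction along a block of coordinates
# preserve the adelic Schwartz–Bruhat space `𝒮(𝔸_K^{ι₁ ⊕ ι₂}) → 𝒮(𝔸_K^{ι₁})`

Cell `hodgecm-mathlib`, crux item hLiu418 = `stmt-HodgeConjecture-24832`; squad K2 ∕ K2Liu, LEAD F0P6-plan (g11) «M-155e» (3), prover K2Liu-p02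
(g4), steward lineage of socket #42R.  THEOREMS ONLY (no `def` ∕ instance ∕ notation ∕ named-fact hypothesis ∕ `sorry`, default heartbeats);
lane `--supports stmt-HodgeConjecture-24832 --as helper` (count-neutral).  The bundled linear maps `piSchwartzBruhat K (ι₁ ⊕ ι₂) →ₗ[ℂ]
piSchwartzBruhat K ι₁` live in the sequel DEFS leaf; this file proves the memberships.

WHY.  In the tree's Schrödinger models (★ `piSchwartzBruhat (Fp L) (Fin k)`, ★ `adelicGram = reindex e (T_V ⊗ₖ T_W)`, `𝕎 = 𝔸^n × 𝔸^n`) the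
Ikeda map `S((𝔻 ⊗ V′₃)⁺(𝔸)) → S((𝔻 ⊗ a′)⁺(𝔸))` behind #42F ([KudlaRallis1994, §5]; [Liu2021, App. B p. 104]) is a rational mover `ω(r_F(δ))` (★)
followed by RESTRICTION to ∕ INTEGRATION along a block of coordinates after a reindexing `Fin 12 ≃ Fin 8 ⊕ Fin 4` (★ `piSBReindex`).  For a
number field `K`, finite `ι₁ ι₂`, an additive Haar measure `ν` on `𝔸_K^{ι₂}` and `Φ ∈ 𝒮(𝔸_K^{ι₁ ⊕ ι₂})`:

* §0 coordinates: `piArch ∕ piFinite` of `Sum.elim x y`; additive uniform local constancy of a locally constant compactly supported function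
  (`exists_nhds_zero_forall_add_eq`, from ★ `Literature.Topology.exists_nhds_one_forall_mul_eq_of_hasCompactSupport` via `Multiplicative`);
* §1 FINITE half (`SchwartzBruhat` = locally constant, compact support on `(𝔸_K^∞)^ι`): `comp_mem_schwartzBruhat_of_leftInverse` (pull-back
  along a continuous map with a continuous left inverse), slices, restriction `x ↦ f(Sum.elim x 0)` and **`fin_fibreIntegral_mem_schwartzBruhat`**
  `x ↦ ∫ f(Sum.elim x y) dμ(y)` — for ANY measure `μ` (no invariance needed: `f(z + (v, 0)) = f z` for `v` near `0`);
* §2 ARCHIMEDEAN half (Mathlib `SchwartzMap` on `(ι → mixedSpace K)`): restriction (`compCLM` along `a ↦ (a, 0)`), integrability of the slices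
  `a′ ↦ Φ_∞(Sum.elim a a′)` against Haar (`‖a′‖ ≤ ‖Sum.elim a a′‖`), and the fibre integral ★ `K2LiuSchwartzFibreIntegral.exists_schwartz_fibreIntegral_sumElim`;
* §3 ASSEMBLY on `𝔸_K^{ι₁ ⊕ ι₂}` (★ `exists_haar_eq_smul_map_prod`: `ν = c · split_*(μ_∞ ⊗ μ_f)`): for factorizable `Φ = Φ_∞ ⊗ Φ_f` every fibre
  `y ↦ Φ(Sum.elim x y)` is `ν`-integrable and `x ↦ ∫ Φ(Sum.elim x y) dν(y) = (c·g_∞) ⊗ g_f` is factorizable; by span induction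
  **`integrable_fibre_of_mem`**, **`fibreIntegral_mem_piSchwartzBruhat`**, **`restrict_mem_piSchwartzBruhat`**, and the additivity ∕ homogeneity
  of the fibre integral on `𝒮` (`fibreIntegral_add`, `fibreIntegral_smul`) that make it a linear map.

NOT here: the bundled `→ₗ[ℂ]` maps (DEFS leaf), the mover, the `8 + 4` split and the FTI constant (#42N ∕ #42F).
HONEST LABEL.  Count-neutral helper; it pays nothing by itself: `HC_CM` is proved only modulo the 7 printed citations (2 remaining named inputs:
hLiu418 = `stmt-HodgeConjecture-24832`, h413 = `stmt-HodgeConjecture-24833`) until rung 0 closes.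
References: [Weil1964] Chap. I n° 11 p. 159 (partial Fourier transform ∕ integration on `𝒮(A × B)`), Chap. III n° 37–38 (restricted products);
[KudlaRallis1994] §5 (Ikeda's map); [Liu2021] App. B p. 104; [CasselsFrohlichANT1967] Ch. XV §3.2 (standard functions).
-/

set_option autoImplicit false
-- the mandated namespace repeats the single-problem summit's segment (`HodgeConjecture.HodgeConjecture`)
set_option linter.dupNamespace false

noncomputable section

open MeasureTheory MeasureTheory.Measure NumberField NumberField.mixedEmbedding IsDedekindDomain Filter Topology
open scoped SchwartzMap NNReal ENNReal Classical
open Literature.NumberTheory.Automorphic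
open Summit.HodgeConjecture.HodgeConjecture.Cruxes.HLiu418.K2LiuSchwartzFibreIntegral

namespace Summit.HodgeConjecture.HodgeConjecture.Cruxes.HLiu418.K2LiuSchwartzBruhatFibreSlices

/-! ## §0 Coordinates of `Sum.elim x y` and uniform local constancy -/

section Coordinates

variable {K : Type} [Field K] [NumberField K] {ι₁ ι₂ : Type}

/-- `piArch (Sum.elim x y) = Sum.elim (piArch x) (piArch y)`. [cite: Weil1964, Chap. III n° 37] -/
theorem piArch_sumElim (x : ι₁ → AdeleRing (𝓞 K) K) (y : ι₂ → AdeleRing (𝓞 K) K) :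
    piArch K (ι₁ ⊕ ι₂) (Sum.elim x y) = Sum.elim (piArch K ι₁ x) (piArch K ι₂ y) := by
  funext i; cases i <;> rfl

/-- `piFinite (Sum.elim x y) = Sum.elim (piFinite x) (piFinite y)`. [cite: Weil1964, Chap. III n° 37] -/
theorem piFinite_sumElim (x : ι₁ → AdeleRing (𝓞 K) K) (y : ι₂ → AdeleRing (𝓞 K) K) :
    piFinite K (ι₁ ⊕ ι₂) (Sum.elim x y) = Sum.elim (piFinite K ι₁ x) (piFinite K ι₂ y) := by
  funext i; cases i <;> rfl

/-- `piArch 0 = 0`. [cite: Weil1964, Chap. III n° 37] -/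
theorem piArch_zero (ι : Type) : piArch K ι (0 : ι → AdeleRing (𝓞 K) K) = 0 := by
  funext i
  rw [piArch_apply]
  exact map_zero _

/-- `piFinite 0 = 0`. [cite: Weil1964, Chap. III n° 37] -/
theorem piFinite_zero (ι : Type) : piFinite K ι (0 : ι → AdeleRing (𝓞 K) K) = 0 := rfl

end Coordinates

section SumElimAlgebra

variable {A : Type*} {ι₁ ι₂ : Type*}

/-- `Sum.elim x y + Sum.elim x' y' = Sum.elim (x + x') (y + y')`. [cite: Weil1964, Chap. III n° 37] -/
theorem sumElim_add_sumElim [Add A] (x x' : ι₁ → A) (y y' : ι₂ → A) :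
    Sum.elim x y + Sum.elim x' y' = Sum.elim (x + x') (y + y') := by
  funext i; cases i <;> rfl

/-- `Sum.elim 0 0 = 0`. [cite: Weil1964, Chap. III n° 37] -/
theorem sumElim_zero_zero [Zero A] : Sum.elim (0 : ι₁ → A) (0 : ι₂ → A) = 0 := by
  funext i; cases i <;> rfl

/-- `x ↦ Sum.elim x y` is continuous. [cite: Weil1964, Chap. III n° 37] -/
theorem continuous_sumElim_left [TopologicalSpace A] (y : ι₂ → A) : Continuous fun x : ι₁ → A => Sum.elim x y :=
  continuous_pi fun i => by
    cases i with
    | inl i => exact continuous_apply i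
    | inr j => exact continuous_const

/-- `y ↦ Sum.elim x y` is continuous. [cite: Weil1964, Chap. III n° 37] -/
theorem continuous_sumElim_right [TopologicalSpace A] (x : ι₁ → A) : Continuous fun y : ι₂ → A => Sum.elim x y :=
  continuous_pi fun i => by
    cases i with
    | inl i => exact continuous_const
    | inr j => exact continuous_apply j

/-- `(x, y) ↦ Sum.elim x y` is continuous. [cite: Weil1964, Chap. III n° 37] -/
theorem continuous_sumElim [TopologicalSpace A] : Continuous fun p : (ι₁ → A) × (ι₂ → A) => Sum.elim p.1 p.2 :=
  continuous_pi fun i => by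
    cases i with
    | inl i => exact (continuous_apply i).comp continuous_fst
    | inr j => exact (continuous_apply j).comp continuous_snd

/-- In the sup norm, `‖y‖ ≤ ‖Sum.elim x y‖`. [cite: Weil1964, Chap. I n° 11] -/
theorem norm_le_norm_sumElim_right [SeminormedAddCommGroup A] [Fintype ι₁] [Fintype ι₂] (x : ι₁ → A) (y : ι₂ → A) :
    ‖y‖ ≤ ‖Sum.elim x y‖ :=
  (pi_norm_le_iff_of_nonneg (norm_nonneg _)).2 fun j => norm_le_pi_norm (Sum.elim x y) (Sum.inr j)

/-- In the sup norm, `‖x‖ ≤ ‖Sum.elim x y‖`. [cite: Weil1964, Chap. I n° 11] -/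
theorem norm_le_norm_sumElim_left [SeminormedAddCommGroup A] [Fintype ι₁] [Fintype ι₂] (x : ι₁ → A) (y : ι₂ → A) :
    ‖x‖ ≤ ‖Sum.elim x y‖ :=
  (pi_norm_le_iff_of_nonneg (norm_nonneg _)).2 fun i => norm_le_pi_norm (Sum.elim x y) (Sum.inl i)

end SumElimAlgebra

section UniformLocalConstancy

variable {A : Type*} [AddGroup A] [TopologicalSpace A] [IsTopologicalAddGroup A] {Y : Type*} [Zero Y]

/-- **Additive uniform local constancy**: a locally constant compactly supported `f` on a topological additive group satisfies
`f (x + v) = f x` for all `x` and all `v` in a neighbourhood of `0` (★ multiplicative version transported along `Multiplicative`).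
[cite: Weil1964, Chap. I n° 11] -/
theorem exists_nhds_zero_forall_add_eq {f : A → Y} (hf : IsLocallyConstant f) (hfs : HasCompactSupport f) :
    ∃ V ∈ 𝓝 (0 : A), ∀ x : A, ∀ v ∈ V, f (x + v) = f x :=
  Literature.Topology.exists_nhds_one_forall_mul_eq_of_hasCompactSupport (G := Multiplicative A)
    (f := fun g : Multiplicative A => f (Multiplicative.toAdd g)) hf hfs

end UniformLocalConstancy

/-! ## §1 The finite half: locally constant compactly supported functions on `(𝔸_K^∞)^{ι₁ ⊕ ι₂}` -/

section Finite

variable {X Z : Type*} [TopologicalSpace X] [T2Space X] [TopologicalSpace Z]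

/-- **Pull-back along a map with a continuous left inverse preserves `SchwartzBruhat`**: if `j : X → Z` is continuous and `r ∘ j = id` with
`r` continuous, then `f ∈ 𝒮(Z) ⇒ f ∘ j ∈ 𝒮(X)` (locally constant by composition; the support of `f ∘ j` lies in the compact `r(tsupport f)`).
[cite: Weil1964, Chap. III n° 37] -/
theorem comp_mem_schwartzBruhat_of_leftInverse {f : Z → ℂ} (hf : f ∈ SchwartzBruhat Z) {j : X → Z} {r : Z → X}
    (hj : Continuous j) (hr : Continuous r) (hrj : ∀ x, r (j x) = x) : (fun x => f (j x)) ∈ SchwartzBruhat X := by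
  refine ⟨hf.1.comp_continuous hj, ?_⟩
  refine HasCompactSupport.intro (hf.2.image hr) fun x hx => ?_
  by_contra hne
  exact hx ⟨j x, subset_tsupport _ (Function.mem_support.2 hne), hrj x⟩

variable {K : Type} [Field K] [NumberField K] {ι₁ ι₂ : Type}

/-- **Restriction to the first block**: `f ∈ 𝒮((𝔸_K^∞)^{ι₁ ⊕ ι₂}) ⇒ (x ↦ f (Sum.elim x 0)) ∈ 𝒮((𝔸_K^∞)^{ι₁})`. [cite: Weil1964, Chap. III n° 37] -/
theorem fin_restrict_mem_schwartzBruhat {f : (ι₁ ⊕ ι₂ → FiniteAdeleRing (𝓞 K) K) → ℂ}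
    (hf : f ∈ SchwartzBruhat (ι₁ ⊕ ι₂ → FiniteAdeleRing (𝓞 K) K)) :
    (fun x : ι₁ → FiniteAdeleRing (𝓞 K) K => f (Sum.elim x 0)) ∈ SchwartzBruhat (ι₁ → FiniteAdeleRing (𝓞 K) K) :=
  haveI := t2Space_finiteAdeleRing K
  comp_mem_schwartzBruhat_of_leftInverse hf (continuous_sumElim_left 0)
    (continuous_pi fun i => continuous_apply (Sum.inl i)) fun _ => rfl

/-- **Slices**: `f ∈ 𝒮((𝔸_K^∞)^{ι₁ ⊕ ι₂}) ⇒ (y ↦ f (Sum.elim x y)) ∈ 𝒮((𝔸_K^∞)^{ι₂})`. [cite: Weil1964, Chap. III n° 37] -/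
theorem fin_slice_mem_schwartzBruhat {f : (ι₁ ⊕ ι₂ → FiniteAdeleRing (𝓞 K) K) → ℂ}
    (hf : f ∈ SchwartzBruhat (ι₁ ⊕ ι₂ → FiniteAdeleRing (𝓞 K) K)) (x : ι₁ → FiniteAdeleRing (𝓞 K) K) :
    (fun y : ι₂ → FiniteAdeleRing (𝓞 K) K => f (Sum.elim x y)) ∈ SchwartzBruhat (ι₂ → FiniteAdeleRing (𝓞 K) K) :=
  haveI := t2Space_finiteAdeleRing K
  comp_mem_schwartzBruhat_of_leftInverse hf (continuous_sumElim_right x)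
    (continuous_pi fun j => continuous_apply (Sum.inr j)) fun _ => rfl

/-- **The finite fibre integral is Schwartz–Bruhat**: for ANY measure `μ` on `(𝔸_K^∞)^{ι₂}` and `f ∈ 𝒮((𝔸_K^∞)^{ι₁ ⊕ ι₂})`, the function
`x ↦ ∫ f (Sum.elim x y) dμ(y)` is locally constant (uniform local constancy of `f` under `z ↦ z + (v, 0)`) with compact support (inside the
projection of `tsupport f`). [cite: Weil1964, Chap. I n° 11] -/
theorem fin_fibreIntegral_mem_schwartzBruhat [MeasurableSpace (FiniteAdeleRing (𝓞 K) K)] (μ : Measure (ι₂ → FiniteAdeleRing (𝓞 K) K))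
    {f : (ι₁ ⊕ ι₂ → FiniteAdeleRing (𝓞 K) K) → ℂ} (hf : f ∈ SchwartzBruhat (ι₁ ⊕ ι₂ → FiniteAdeleRing (𝓞 K) K)) :
    (fun x : ι₁ → FiniteAdeleRing (𝓞 K) K => ∫ y, f (Sum.elim x y) ∂μ) ∈ SchwartzBruhat (ι₁ → FiniteAdeleRing (𝓞 K) K) := by
  refine ⟨?_, ?_⟩
  · -- locally constant
    obtain ⟨V, hV, hVf⟩ := exists_nhds_zero_forall_add_eq hf.1 hf.2
    set V₁ : Set (ι₁ → FiniteAdeleRing (𝓞 K) K) := (fun v => Sum.elim v (0 : ι₂ → FiniteAdeleRing (𝓞 K) K)) ⁻¹' V with hV₁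
    have hV₁n : V₁ ∈ 𝓝 (0 : ι₁ → FiniteAdeleRing (𝓞 K) K) := by
      refine (continuous_sumElim_left (0 : ι₂ → FiniteAdeleRing (𝓞 K) K)).continuousAt.preimage_mem_nhds ?_
      rwa [sumElim_zero_zero]
    refine (IsLocallyConstant.iff_eventually_eq _).2 fun x => ?_
    rw [← map_add_left_nhds_zero x, Filter.eventually_map]
    filter_upwards [hV₁n] with v hv
    refine integral_congr_ae (Eventually.of_forall fun y => ?_)
    have h := hVf (Sum.elim x y) (Sum.elim v 0) hv
    rwa [sumElim_add_sumElim, add_zero] at h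
  · -- compact support
    haveI := t2Space_finiteAdeleRing K
    refine HasCompactSupport.intro (hf.2.image (continuous_pi fun i => continuous_apply (Sum.inl i))) fun x hx => ?_
    have h0 : ∀ y, f (Sum.elim x y) = 0 := fun y => by
      by_contra hne
      exact hx ⟨Sum.elim x y, subset_tsupport _ (Function.mem_support.2 hne), rfl⟩
    simp only [h0, integral_zero]

end Finite

/-! ## §2 The archimedean half: Schwartz functions on `(K ⊗ ℝ)^{ι₁ ⊕ ι₂}` -/

section Archimedean

variable {W : Type*} [NormedAddCommGroup W] [NormedSpace ℝ W] {ι₁ ι₂ : Type} [Fintype ι₁] [Fintype ι₂]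
  {F : Type*} [NormedAddCommGroup F] [NormedSpace ℂ F]

/-- **Archimedean restriction**: `Φ ∈ 𝓢(ι₁ ⊕ ι₂ → W) ⇒ ∃ g ∈ 𝓢(ι₁ → W)` with `g a = Φ (Sum.elim a 0)` (Mathlib `SchwartzMap.compCLM` along the
linear injection `a ↦ Sum.elim a 0`, whose norm growth is controlled by `‖a‖ ≤ ‖Sum.elim a 0‖`). [cite: Weil1964, Chap. I n° 11] -/
theorem arch_restrict (Φ : 𝓢((ι₁ ⊕ ι₂ → W), F)) : ∃ g : 𝓢((ι₁ → W), F), ∀ a, g a = Φ (Sum.elim a 0) := by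
  set S : (ι₁ ⊕ ι₂ → W) ≃L[ℝ] (ι₁ → W) × (ι₂ → W) := ContinuousLinearEquiv.sumPiEquivProdPi ℝ ι₁ ι₂ (fun _ => W) with hS
  set L : (ι₁ → W) →L[ℝ] (ι₁ ⊕ ι₂ → W) := (S.symm : (ι₁ → W) × (ι₂ → W) →L[ℝ] (ι₁ ⊕ ι₂ → W)).comp
    (ContinuousLinearMap.inl ℝ (ι₁ → W) (ι₂ → W)) with hL
  have hLapply : ∀ a, L a = Sum.elim a 0 := fun a => by
    funext i; rcases i with i | i <;> rfl
  have hgrowth : Function.HasTemperateGrowth (L : (ι₁ → W) → (ι₁ ⊕ ι₂ → W)) := L.hasTemperateGrowth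
  have hupper : ∃ (k : ℕ) (C : ℝ), ∀ a : ι₁ → W, ‖a‖ ≤ C * (1 + ‖(L : (ι₁ → W) → (ι₁ ⊕ ι₂ → W)) a‖) ^ k := by
    refine ⟨1, 1, fun a => ?_⟩
    rw [pow_one, one_mul, hLapply]
    linarith [norm_le_norm_sumElim_left a (0 : ι₂ → W), norm_nonneg (Sum.elim a (0 : ι₂ → W))]
  refine ⟨SchwartzMap.compCLM ℂ hgrowth hupper Φ, fun a => ?_⟩
  rw [SchwartzMap.compCLM_apply, Function.comp_apply, hLapply]

variable [FiniteDimensional ℝ W] [MeasurableSpace W] [BorelSpace W]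

/-- **Archimedean slices are integrable against Haar**: for `Φ ∈ 𝓢(ι₁ ⊕ ι₂ → W)`, `a` fixed and an additive Haar measure `μ` on `ι₂ → W`,
`a′ ↦ Φ (Sum.elim a a′)` is integrable (Schwartz decay and `‖a′‖ ≤ ‖Sum.elim a a′‖`). [cite: Weil1964, Chap. I n° 11] -/
theorem arch_integrable_slice (Φ : 𝓢((ι₁ ⊕ ι₂ → W), F)) (μ : Measure (ι₂ → W)) [μ.IsAddHaarMeasure] (a : ι₁ → W) :
    Integrable (fun a' : ι₂ → W => Φ (Sum.elim a a')) μ := by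
  haveI : BorelSpace (ι₂ → W) := Pi.borelSpace
  obtain ⟨C, hC0, hC⟩ := schwartz_norm_le_mul_one_add_norm_rpow_neg Φ (Module.finrank ℝ (ι₂ → W) + 1)
  have hint : Integrable (fun a' : ι₂ → W => C * (1 + ‖a'‖) ^ (-((Module.finrank ℝ (ι₂ → W) + 1 : ℕ) : ℝ))) μ :=
    (integrable_one_add_norm (by push_cast; linarith)).const_mul C
  refine hint.mono' ((Φ.continuous.comp (continuous_sumElim_right a)).aestronglyMeasurable)
    (Eventually.of_forall fun a' => (hC _).trans ?_)
  have hpos : 0 < 1 + ‖a'‖ := by positivity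
  have hle : (1 + ‖Sum.elim a a'‖) ^ (-((Module.finrank ℝ (ι₂ → W) + 1 : ℕ) : ℝ)) ≤
      (1 + ‖a'‖) ^ (-((Module.finrank ℝ (ι₂ → W) + 1 : ℕ) : ℝ)) :=
    Real.rpow_le_rpow_of_nonpos hpos (by linarith [norm_le_norm_sumElim_right a a']) (neg_nonpos.2 (Nat.cast_nonneg _))
  exact mul_le_mul_of_nonneg_left hle hC0

end Archimedean

/-! ## §3 Assembly on `𝔸_K^{ι₁ ⊕ ι₂}` -/

section Adelic

variable {K : Type} [Field K] [NumberField K] {ι₁ ι₂ : Type} [Fintype ι₁] [Fintype ι₂]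

/-- **Restriction of a factorizable function is factorizable**: `(Φ_∞ ⊗ Φ_f)(Sum.elim x 0) = Φ_∞(Sum.elim x_∞ 0) · Φ_f(Sum.elim x_f 0)`.
[cite: Weil1964, Chap. I n° 11] [cite: KudlaRallis1994, §5] -/
theorem isFactorizable_restrict {Φ : (ι₁ ⊕ ι₂ → AdeleRing (𝓞 K) K) → ℂ} (h : IsFactorizablePiSchwartzBruhat K (ι₁ ⊕ ι₂) Φ) :
    IsFactorizablePiSchwartzBruhat K ι₁ (fun x => Φ (Sum.elim x 0)) := by
  obtain ⟨Φinf, Φfin, hfin, rfl⟩ := h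
  obtain ⟨g, hg⟩ := arch_restrict Φinf
  refine ⟨g, fun b => Φfin (Sum.elim b 0), fin_restrict_mem_schwartzBruhat hfin, funext fun x => ?_⟩
  simp only [piArch_sumElim, piFinite_sumElim, piArch_zero, piFinite_zero, hg]

/-- **RESTRICTION TO A BLOCK OF COORDINATES PRESERVES THE SCHWARTZ–BRUHAT SPACE**: `Φ ∈ 𝒮(𝔸_K^{ι₁ ⊕ ι₂}) ⇒ (x ↦ Φ(Sum.elim x 0)) ∈ 𝒮(𝔸_K^{ι₁})`.
[cite: Weil1964, Chap. I n° 11] [cite: KudlaRallis1994, §5] -/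
theorem restrict_mem_piSchwartzBruhat {Φ : (ι₁ ⊕ ι₂ → AdeleRing (𝓞 K) K) → ℂ} (h : Φ ∈ piSchwartzBruhat K (ι₁ ⊕ ι₂)) :
    (fun x => Φ (Sum.elim x 0)) ∈ piSchwartzBruhat K ι₁ := by
  induction h using Submodule.span_induction with
  | mem Φ hΦ => exact mem_piSchwartzBruhat (isFactorizable_restrict hΦ)
  | zero => exact (piSchwartzBruhat K ι₁).zero_mem
  | add Φ Ψ _ _ hΦ hΨ => exact add_mem hΦ hΨ
  | smul a Φ _ hΦ => exact Submodule.smul_mem _ a hΦ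

variable [MeasurableSpace (AdeleRing (𝓞 K) K)] [BorelSpace (AdeleRing (𝓞 K) K)]
  (ν : Measure (ι₂ → AdeleRing (𝓞 K) K)) [ν.IsAddHaarMeasure]

omit [MeasurableSpace (AdeleRing (𝓞 K) K)] [BorelSpace (AdeleRing (𝓞 K) K)] in
/-- The fibre of a factorizable function over `x`, read through the splitting `𝔸^{ι₂} ≅ (K ⊗ ℝ)^{ι₂} × (𝔸^∞)^{ι₂}`, is a product of an archimedean
slice and a finite slice. [cite: Weil1964, Chap. III n° 38] -/
theorem fibre_comp_piAdeleSplit (Φinf : 𝓢((ι₁ ⊕ ι₂ → mixedSpace K), ℂ)) (Φfin : (ι₁ ⊕ ι₂ → FiniteAdeleRing (𝓞 K) K) → ℂ)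
    (x : ι₁ → AdeleRing (𝓞 K) K) :
    (fun p : (ι₂ → mixedSpace K) × (ι₂ → FiniteAdeleRing (𝓞 K) K) =>
        Φinf (piArch K (ι₁ ⊕ ι₂) (Sum.elim x (piAdeleSplit K ι₂ p))) * Φfin (piFinite K (ι₁ ⊕ ι₂) (Sum.elim x (piAdeleSplit K ι₂ p)))) =
      fun p => Φinf (Sum.elim (piArch K ι₁ x) p.1) * Φfin (Sum.elim (piFinite K ι₁ x) p.2) := by
  funext p
  rw [piArch_sumElim, piFinite_sumElim, piArch_piAdeleSplit, piFinite_piAdeleSplit]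

/-- **Fibres of a factorizable Schwartz–Bruhat function are integrable**: `y ↦ (Φ_∞ ⊗ Φ_f)(Sum.elim x y)` is `ν`-integrable for every additive
Haar measure `ν` on `𝔸_K^{ι₂}` (Fubini along `ν = c · split_*(μ_∞ ⊗ μ_f)`). [cite: Weil1964, Chap. I n° 11] -/
theorem integrable_fibre_of_isFactorizable {Φ : (ι₁ ⊕ ι₂ → AdeleRing (𝓞 K) K) → ℂ} (h : IsFactorizablePiSchwartzBruhat K (ι₁ ⊕ ι₂) Φ)
    (x : ι₁ → AdeleRing (𝓞 K) K) : Integrable (fun y => Φ (Sum.elim x y)) ν := by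
  obtain ⟨Φinf, Φfin, hfin, rfl⟩ := h
  haveI : SecondCountableTopology (FiniteAdeleRing (𝓞 K) K) := secondCountableTopology_finiteAdeleRing (K := K)
  haveI : LocallyCompactSpace (FiniteAdeleRing (𝓞 K) K) := locallyCompactSpace_finiteAdeleRing' (K := K)
  haveI : SecondCountableTopology (AdeleRing (𝓞 K) K) := secondCountableTopology_adeleRing (K := K)
  haveI : LocallyCompactSpace (AdeleRing (𝓞 K) K) := locallyCompactSpace_adeleRing' (K := K)
  letI : MeasurableSpace (FiniteAdeleRing (𝓞 K) K) := borel _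
  haveI : BorelSpace (FiniteAdeleRing (𝓞 K) K) := ⟨rfl⟩
  haveI : BorelSpace (ι₂ → FiniteAdeleRing (𝓞 K) K) := Pi.borelSpace
  haveI : BorelSpace (ι₂ → mixedSpace K) := Pi.borelSpace
  set μE : Measure (ι₂ → mixedSpace K) := Measure.addHaar with hμE
  set μf : Measure (ι₂ → FiniteAdeleRing (𝓞 K) K) := Measure.addHaar with hμf
  obtain ⟨c, hc, hν⟩ := exists_haar_eq_smul_map_prod K ι₂ ν μE μf
  rw [integrable_iff_integrable_prod hc hν, fibre_comp_piAdeleSplit]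
  exact (arch_integrable_slice Φinf μE (piArch K ι₁ x)).mul_prod
    (integrable_of_mem_schwartzBruhat K μf (fin_slice_mem_schwartzBruhat hfin (piFinite K ι₁ x)))

/-- **The fibre integral of a factorizable Schwartz–Bruhat function is factorizable**: with `ν = c · split_*(μ_∞ ⊗ μ_f)`,
`∫ (Φ_∞ ⊗ Φ_f)(Sum.elim x y) dν(y) = c · (∫ Φ_∞(Sum.elim x_∞ a) dμ_∞(a)) · (∫ Φ_f(Sum.elim x_f b) dμ_f(b))`, an archimedean Schwartz function
(★ `exists_schwartz_fibreIntegral_sumElim`) times a finite Schwartz–Bruhat function (`fin_fibreIntegral_mem_schwartzBruhat`).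
[cite: Weil1964, Chap. I n° 11] [cite: KudlaRallis1994, §5] -/
theorem isFactorizable_fibreIntegral {Φ : (ι₁ ⊕ ι₂ → AdeleRing (𝓞 K) K) → ℂ} (h : IsFactorizablePiSchwartzBruhat K (ι₁ ⊕ ι₂) Φ) :
    IsFactorizablePiSchwartzBruhat K ι₁ (fun x => ∫ y, Φ (Sum.elim x y) ∂ν) := by
  obtain ⟨Φinf, Φfin, hfin, rfl⟩ := h
  haveI : SecondCountableTopology (FiniteAdeleRing (𝓞 K) K) := secondCountableTopology_finiteAdeleRing (K := K)
  haveI : LocallyCompactSpace (FiniteAdeleRing (𝓞 K) K) := locallyCompactSpace_finiteAdeleRing' (K := K)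
  haveI : SecondCountableTopology (AdeleRing (𝓞 K) K) := secondCountableTopology_adeleRing (K := K)
  haveI : LocallyCompactSpace (AdeleRing (𝓞 K) K) := locallyCompactSpace_adeleRing' (K := K)
  letI : MeasurableSpace (FiniteAdeleRing (𝓞 K) K) := borel _
  haveI : BorelSpace (FiniteAdeleRing (𝓞 K) K) := ⟨rfl⟩
  haveI : BorelSpace (ι₂ → FiniteAdeleRing (𝓞 K) K) := Pi.borelSpace
  haveI : BorelSpace (ι₂ → mixedSpace K) := Pi.borelSpace
  set μE : Measure (ι₂ → mixedSpace K) := Measure.addHaar with hμE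
  set μf : Measure (ι₂ → FiniteAdeleRing (𝓞 K) K) := Measure.addHaar with hμf
  obtain ⟨c, -, hν⟩ := exists_haar_eq_smul_map_prod K ι₂ ν μE μf
  obtain ⟨g, hg⟩ := exists_schwartz_fibreIntegral_sumElim Φinf μE
  refine ⟨(c : ℂ) • g, fun b => ∫ b', Φfin (Sum.elim b b') ∂μf, fin_fibreIntegral_mem_schwartzBruhat μf hfin, funext fun x => ?_⟩
  rw [integral_eq_smul_integral_prod hν]
  change (c : ℝ) • ∫ p, Φinf (piArch K (ι₁ ⊕ ι₂) (Sum.elim x (piAdeleSplit K ι₂ p))) *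
      Φfin (piFinite K (ι₁ ⊕ ι₂) (Sum.elim x (piAdeleSplit K ι₂ p))) ∂(μE.prod μf) = _
  rw [fibre_comp_piAdeleSplit, integral_prod_mul (fun a : ι₂ → mixedSpace K => Φinf (Sum.elim (piArch K ι₁ x) a))
    (fun b : ι₂ → FiniteAdeleRing (𝓞 K) K => Φfin (Sum.elim (piFinite K ι₁ x) b)), _root_.smul_apply, hg, smul_eq_mul,
    Complex.real_smul, mul_assoc]

/-- **Every fibre of a Schwartz–Bruhat function on `𝔸_K^{ι₁ ⊕ ι₂}` is integrable on `𝔸_K^{ι₂}`** (span induction from the factorizable case).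
[cite: Weil1964, Chap. I n° 11] -/
theorem integrable_fibre_of_mem {Φ : (ι₁ ⊕ ι₂ → AdeleRing (𝓞 K) K) → ℂ} (h : Φ ∈ piSchwartzBruhat K (ι₁ ⊕ ι₂))
    (x : ι₁ → AdeleRing (𝓞 K) K) : Integrable (fun y => Φ (Sum.elim x y)) ν := by
  induction h using Submodule.span_induction with
  | mem Φ hΦ => exact integrable_fibre_of_isFactorizable ν hΦ x
  | zero => exact integrable_zero _ _ ν
  | add Φ Ψ _ _ hΦ hΨ => exact hΦ.add hΨ
  | smul a Φ _ hΦ => exact hΦ.smul a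

/-- Additivity of the fibre integral on `𝒮(𝔸_K^{ι₁ ⊕ ι₂})` (integrable fibres). [cite: Weil1964, Chap. I n° 11] -/
theorem fibreIntegral_add {Φ Ψ : (ι₁ ⊕ ι₂ → AdeleRing (𝓞 K) K) → ℂ} (hΦ : Φ ∈ piSchwartzBruhat K (ι₁ ⊕ ι₂))
    (hΨ : Ψ ∈ piSchwartzBruhat K (ι₁ ⊕ ι₂)) :
    (fun x => ∫ y, (Φ + Ψ) (Sum.elim x y) ∂ν) = (fun x => ∫ y, Φ (Sum.elim x y) ∂ν) + fun x => ∫ y, Ψ (Sum.elim x y) ∂ν := by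
  funext x
  simp only [Pi.add_apply]
  exact integral_add (integrable_fibre_of_mem ν hΦ x) (integrable_fibre_of_mem ν hΨ x)

omit [Fintype ι₁] [Fintype ι₂] [BorelSpace (AdeleRing (𝓞 K) K)] [ν.IsAddHaarMeasure] in
/-- Homogeneity of the fibre integral. [cite: Weil1964, Chap. I n° 11] -/
theorem fibreIntegral_smul (a : ℂ) (Φ : (ι₁ ⊕ ι₂ → AdeleRing (𝓞 K) K) → ℂ) :
    (fun x => ∫ y, (a • Φ) (Sum.elim x y) ∂ν) = a • fun x => ∫ y, Φ (Sum.elim x y) ∂ν := by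
  funext x
  simp only [Pi.smul_apply, smul_eq_mul]
  exact integral_const_mul a _

/-- **INTEGRATION ALONG A BLOCK OF COORDINATES PRESERVES THE SCHWARTZ–BRUHAT SPACE**: for `Φ ∈ 𝒮(𝔸_K^{ι₁ ⊕ ι₂})` and an additive Haar
measure `ν` on `𝔸_K^{ι₂}`, `x ↦ ∫ Φ(Sum.elim x y) dν(y) ∈ 𝒮(𝔸_K^{ι₁})` (span induction; additivity from integrable fibres).
[cite: Weil1964, Chap. I n° 11] [cite: KudlaRallis1994, §5] -/
theorem fibreIntegral_mem_piSchwartzBruhat {Φ : (ι₁ ⊕ ι₂ → AdeleRing (𝓞 K) K) → ℂ} (h : Φ ∈ piSchwartzBruhat K (ι₁ ⊕ ι₂)) :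
    (fun x => ∫ y, Φ (Sum.elim x y) ∂ν) ∈ piSchwartzBruhat K ι₁ := by
  induction h using Submodule.span_induction with
  | mem Φ hΦ => exact mem_piSchwartzBruhat (isFactorizable_fibreIntegral ν hΦ)
  | zero =>
    have h0 : (fun x : ι₁ → AdeleRing (𝓞 K) K => ∫ y, (0 : (ι₁ ⊕ ι₂ → AdeleRing (𝓞 K) K) → ℂ) (Sum.elim x y) ∂ν) = 0 := by
      funext x; simp only [Pi.zero_apply, integral_zero]
    rw [h0]
    exact (piSchwartzBruhat K ι₁).zero_mem
  | add Φ Ψ hΦm hΨm hΦ hΨ =>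
    rw [fibreIntegral_add ν hΦm hΨm]
    exact add_mem hΦ hΨ
  | smul a Φ _ hΦ =>
    rw [fibreIntegral_smul ν a Φ]
    exact Submodule.smul_mem _ a hΦ

end Adelic

end Summit.HodgeConjecture.HodgeConjecture.Cruxes.HLiu418.K2LiuSchwartzBruhatFibreSlices

end
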